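import Mathlib
import HarnessLib
import Summits.Ventures.LatticeQCDFlow.Scoring.ChainEDFBandMinorised
import Summits.Ventures.LatticeQCDFlow.Exactness.NCMCGeneralSpaceOccupancyChainMixing
import Summits.Ventures.LatticeQCDFlow.Exactness.NCMCGeneralSpaceOccupancyChainDoeblinMirror
import Summits.Ventures.LatticeQCDFlow.Exactness.NCMCGeneralSpaceOccupancyChainErrorBars

/-!
# The NCMC lane at FINITE `n`: a distribution-free Gaussian tail for the level occupancy from EVERY initial law, `P{|p̂_n − σ(c−ΔF)| ≥ t} ≤ 2 exp(−(nt − 8(1+σ)/e)² / (32 n (1+σ)²/e²))`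

HONEST FRAMING: exact (Metropolis-corrected) sampling algorithms for lattice gauge theory;
figures of merit are autocorrelation/cost numbers at stated couplings and volumes; no
continuum-physics claim.

Venture `LatticeQCDFlow` (cell pub-lqcd), topic `Exactness`; FANOUT row 13 (`eng-snf`, GEN-22).
NEW WORK of the cell, not a published result; no definition is introduced; nothing is cited as a
fact (Glynn–Ormoneit 2002 NAMED ONLY).  GEN-19/20 gave the NCMC lane ASYMPTOTICALLY exact error bars
(`NCMCGeneralSpaceOccupancyChainCoverage`, `…GammaCoverageUnconditional`) and GEN-18 the certified
`O(1/n)` burn-in of the occupancy; "finite-`n` coverage" stayed on the NOT-CLAIMED lists because row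
8's Hoeffding files need a minorisation by the invariant law itself, which the NCMC iteration kernel
`Q = switchKernel ∘ₖ levelKernel T₀ T₁` does not have.  Row 4's `Scoring/ChainEDFBandMinorised`
(`chain_abs_tail_le_exp_of_nHit_minorised`) has since removed that restriction — an `m`-step
minorisation by an ARBITRARY law suffices — and GEN-18's certificate is exactly of that shape
(`ε • ν ≤ Q²(z, ·)`).  This file composes the two: a finite-`n`, distribution-free confidence
statement for the printed occupancy `p̂_n` (hence for `σ(c − ΔF)`, and through the monotone
`x ↦ c − log(x/(1−x))` for `ΔF`) from EVERY initial state of the expanded ensemble.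

## Content (Crooks pair between finite weights, `Z₀, Z₁ ≠ 0`, `e^{−ΔF} = Z₁/Z₀`; level samplers
## `T₀`, `T₁` leaving `ν₀`, `ν₁` invariant; the two-step certificate `ε • ν ≤ nHit Q 2 z` for all `z`,
## `ε ≠ 0`; `σ = σ(c − ΔF)`, `e = ε.toReal`; `p̂_n = (1/n) Σ_{t<n} 1_target(X_t)`; `μ₀` ANY initial law)

* **`CrooksPair.ncmc_occupancy_tail_le_exp_of_sq`** — `n ≠ 0`, `n t ≥ 8(1+σ)/e`:
  `P_{μ₀}{ t ≤ |p̂_n − σ| } ≤ 2 exp(−(n t − 8(1+σ)/e)² / (32 n (1+σ)² / e²))`.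
* **`CrooksPair.ncmc_occupancy_tail_le_exp_of_sq'`** — the `σ`-free form (`1 + σ ≤ 2`), `n t ≥ 16/e`:
  `P_{μ₀}{ t ≤ |p̂_n − σ| } ≤ 2 exp(−(n t − 16/e)² e² / (128 n))`.
* **`CrooksPair.ncmc_occupancy_confidence_of_sq`** — the CONFIDENCE form: `σ(c − ΔF) ∈ (p̂_n − t, p̂_n + t)`
  with `P_{μ₀}`-probability at least `1 − 2 exp(−(n t − 16/e)² e² / (128 n))`.
* **`CrooksPair.ncmc_occupancy_confidence_of_ne`** — `c ≠ ΔF`, level samplers dominating measures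
  that dominate `ν₀`, `ν₁`: SOME certificate `ε > 0` exists (GEN-18), hence the confidence statement
  with that `ε`.
* `freeEnergy_mem_Ioo_of_abs_sub_sigmoid_lt` (pointwise: `|p − σ(c−ΔF)| < t`, `t < p`, `p + t < 1` ⇒
  `c − log((p+t)/(1−p−t)) < ΔF < c − log((p−t)/(1−p+t))`) and
  **`CrooksPair.ncmc_freeEnergy_confidence_of_sq`** — the FREE-ENERGY form: with probability at least
  `1 − 2 exp(−(n t − 16/e)² e² / (128 n))`, whenever the printed interval is proper (`t < p̂_n`,
  `p̂_n + t < 1`) it brackets `ΔF`: `c − log((p̂_n+t)/(1−p̂_n−t)) < ΔF < c − log((p̂_n−t)/(1−p̂_n+t))`.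

Reading (value-free): with a certificate `(ε, 2)` in hand, `n` NCMC iterations from any start give
an honest, non-asymptotic interval for the level occupancy — Gaussian tails of rate `e² t²/128`
per iteration after an offset `16/e` — with no stationarity, no variance estimate and no CLT.
NOT CLAIMED: sharp constants (the true rate involves `τ_int`, GEN-19/21); a value of `ε` for a
concrete protocol; the degenerate case `c = ΔF` with `W ≡ ΔF`; anything numerical.
-/

namespace Summit.Ventures.LatticeQCDFlow.Exactness.GeneralNCMC

open MeasureTheory ProbabilityTheory Set Filter Finset
open scoped ENNReal Topology

variable {Ω E : Type*} [MeasurableSpace Ω] [MeasurableSpace E]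

section NCMC

variable {ν₀ ν₁ : Measure Ω} [IsFiniteMeasure ν₀] [IsFiniteMeasure ν₁]
  {κF κR : Kernel Ω E} [IsMarkovKernel κF] [IsMarkovKernel κR] {s e : E → Ω} {W : E → ℝ} {c : ℝ}
  {T₀ T₁ : Kernel Ω Ω} [IsMarkovKernel T₀] [IsMarkovKernel T₁] {ε : ℝ≥0∞}
  {ν : Measure (Bool × Ω)} [IsProbabilityMeasure ν]

/-- **HOEFFDING FOR THE NCMC OCCUPANCY, FROM EVERY INITIAL LAW.**  Crooks pair with `Z₀, Z₁ ≠ 0` and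
`e^{−ΔF} = Z₁/Z₀`; level samplers leaving `ν₀`, `ν₁` invariant; two-step certificate
`ε • ν ≤ nHit Q 2 z` for all `z` (`ε ≠ 0`); `σ = σ(c − ΔF)`, `e = ε.toReal`.  For every initial law
`μ₀`, every `n ≠ 0` and every `t` with `n t ≥ 8 (1 + σ)/e`:
`P_{μ₀}{ t ≤ |p̂_n − σ| } ≤ 2 exp(−(n t − 8(1+σ)/e)² / (32 n (1+σ)²/e²))`. -/
theorem CrooksPair.ncmc_occupancy_tail_le_exp_of_sq (h : CrooksPair ν₀ ν₁ κF κR s e W)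
    (h0 : ν₀ univ ≠ 0) (h1 : ν₁ univ ≠ 0) (hT₀ : Kernel.Invariant T₀ ν₀)
    (hT₁ : Kernel.Invariant T₁ ν₁) (hε : ε ≠ 0)
    (hD : haveI := isMarkovKernel_switchKernel (κF := κF) (κR := κR) (c := c)
              h.measurable_W h.measurable_s h.measurable_e
      ∀ z, ε • ν ≤ nHit (switchKernel κF κR c W s e ∘ₖ levelKernel T₀ T₁) 2 z)
    {ΔF : ℝ} (hΔF : Real.exp (-ΔF) = ((ν₀ univ)⁻¹ * ν₁ univ).toReal)
    (μ₀ : Measure (Bool × Ω)) [IsProbabilityMeasure μ₀] {n : ℕ} (hn : n ≠ 0) {t : ℝ}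
    (ht : 8 * (1 + Real.sigmoid (c - ΔF)) / ε.toReal ≤ n * t) :
    haveI := isMarkovKernel_switchKernel (κF := κF) (κR := κR) (c := c)
      h.measurable_W h.measurable_s h.measurable_e
    haveI := isMarkovKernel_levelKernel T₀ T₁
    (Kernel.trajMeasure (X := fun _ : ℕ => Bool × Ω) μ₀
        (fun n : ℕ => (switchKernel κF κR c W s e ∘ₖ levelKernel T₀ T₁).comap
          (fun hh : (j : ↥(Finset.Iic n)) → Bool × Ω => hh ⟨n, Finset.mem_Iic.2 le_rfl⟩)
          (measurable_pi_apply _))).real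
        {x | t ≤ |(∑ i ∈ range n, (targetLevel Ω).indicator (1 : Bool × Ω → ℝ) (x i)) / n
          - Real.sigmoid (c - ΔF)|}
      ≤ 2 * Real.exp (-(n * t - 8 * (1 + Real.sigmoid (c - ΔF)) / ε.toReal) ^ 2
          / (32 * n * (1 + Real.sigmoid (c - ΔF)) ^ 2 / ε.toReal ^ 2)) := by
  haveI := isMarkovKernel_switchKernel (κF := κF) (κR := κR) (c := c)
    h.measurable_W h.measurable_s h.measurable_e
  haveI := isMarkovKernel_levelKernel T₀ T₁
  haveI := isProbabilityMeasure_jointLaw c ν₀ ν₁ h0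
  obtain ⟨x0, -⟩ := nonempty_of_measure_ne_zero h0
  haveI : Nonempty (Bool × Ω) := ⟨(false, x0)⟩
  haveI := isMarkovKernel_nHit (switchKernel κF κR c W s e ∘ₖ levelKernel T₀ T₁) 2
  obtain ⟨hgm, hg0, hg1⟩ := targetLevel_indicator_mem (Ω := Ω)
  have hC : ∀ p, |(targetLevel Ω).indicator (1 : Bool × Ω → ℝ) p| ≤ 1 := fun p => by
    rw [abs_of_nonneg (hg0 p)]; exact hg1 p
  have hmean := integral_jointLaw_targetLevel_indicator c ν₀ ν₁ h0 h1 hΔF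
  have hσ0 : 0 ≤ Real.sigmoid (c - ΔF) := Real.sigmoid_nonneg _
  have key := Scoring.GlivenkoCantelli.chain_abs_tail_le_exp_of_nHit_minorised (μ₀ := μ₀)
    (invariant_smul _ (iteration_invariant h hT₀ hT₁ c) (jointWeight c ν₀ ν₁ univ)⁻¹)
    (fun x B hB => minorised_setwise hD x hB) two_pos (pos_iff_ne_zero.2 hε)
    (eps_le_one_of_minorised hD) hgm hC hn (s := t)
    (by
      rw [hmean, abs_of_nonneg hσ0]
      have : (4 : ℝ) * (2 : ℕ) * (1 + Real.sigmoid (c - ΔF)) / ε.toReal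
          = 8 * (1 + Real.sigmoid (c - ΔF)) / ε.toReal := by push_cast; ring
      rw [this]; exact ht)
  rw [hmean, abs_of_nonneg hσ0] at key
  have h8 : (4 : ℝ) * (2 : ℕ) * (1 + Real.sigmoid (c - ΔF)) / ε.toReal
      = 8 * (1 + Real.sigmoid (c - ΔF)) / ε.toReal := by push_cast; ring
  have h32 : (8 : ℝ) * n * ((2 : ℕ) : ℝ) ^ 2 * (1 + Real.sigmoid (c - ΔF)) ^ 2 / ε.toReal ^ 2
      = 32 * n * (1 + Real.sigmoid (c - ΔF)) ^ 2 / ε.toReal ^ 2 := by push_cast; ring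
  rw [h8, h32] at key
  exact key

/-- **The `σ`-free tail** (`1 + σ ≤ 2`): for every initial law, `n ≠ 0`, `n t ≥ 16/e`:
`P_{μ₀}{ t ≤ |p̂_n − σ(c−ΔF)| } ≤ 2 exp(−(n t − 16/e)² e² / (128 n))`. -/
theorem CrooksPair.ncmc_occupancy_tail_le_exp_of_sq' (h : CrooksPair ν₀ ν₁ κF κR s e W)
    (h0 : ν₀ univ ≠ 0) (h1 : ν₁ univ ≠ 0) (hT₀ : Kernel.Invariant T₀ ν₀)
    (hT₁ : Kernel.Invariant T₁ ν₁) (hε : ε ≠ 0)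
    (hD : haveI := isMarkovKernel_switchKernel (κF := κF) (κR := κR) (c := c)
              h.measurable_W h.measurable_s h.measurable_e
      ∀ z, ε • ν ≤ nHit (switchKernel κF κR c W s e ∘ₖ levelKernel T₀ T₁) 2 z)
    {ΔF : ℝ} (hΔF : Real.exp (-ΔF) = ((ν₀ univ)⁻¹ * ν₁ univ).toReal)
    (μ₀ : Measure (Bool × Ω)) [IsProbabilityMeasure μ₀] {n : ℕ} (hn : n ≠ 0) {t : ℝ}
    (ht : 16 / ε.toReal ≤ n * t) :
    haveI := isMarkovKernel_switchKernel (κF := κF) (κR := κR) (c := c)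
      h.measurable_W h.measurable_s h.measurable_e
    haveI := isMarkovKernel_levelKernel T₀ T₁
    (Kernel.trajMeasure (X := fun _ : ℕ => Bool × Ω) μ₀
        (fun n : ℕ => (switchKernel κF κR c W s e ∘ₖ levelKernel T₀ T₁).comap
          (fun hh : (j : ↥(Finset.Iic n)) → Bool × Ω => hh ⟨n, Finset.mem_Iic.2 le_rfl⟩)
          (measurable_pi_apply _))).real
        {x | t ≤ |(∑ i ∈ range n, (targetLevel Ω).indicator (1 : Bool × Ω → ℝ) (x i)) / n
          - Real.sigmoid (c - ΔF)|}
      ≤ 2 * Real.exp (-((n * t - 16 / ε.toReal) ^ 2 * ε.toReal ^ 2 / (128 * n))) := by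
  haveI := isMarkovKernel_switchKernel (κF := κF) (κR := κR) (c := c)
    h.measurable_W h.measurable_s h.measurable_e
  haveI := isMarkovKernel_levelKernel T₀ T₁
  obtain ⟨x0, -⟩ := nonempty_of_measure_ne_zero h0
  haveI : Nonempty (Bool × Ω) := ⟨(false, x0)⟩
  haveI := isMarkovKernel_nHit (switchKernel κF κR c W s e ∘ₖ levelKernel T₀ T₁) 2
  set σ := Real.sigmoid (c - ΔF) with hσ
  have hσ0 : 0 ≤ σ := Real.sigmoid_nonneg _
  have hσ1 : σ ≤ 1 := Real.sigmoid_le_one _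
  have hε1 : ε ≤ 1 := eps_le_one_of_minorised hD
  have hεtop : ε ≠ ∞ := ne_top_of_le_ne_top ENNReal.one_ne_top hε1
  have hepos : 0 < ε.toReal := ENNReal.toReal_pos hε hεtop
  have hn' : (0 : ℝ) < n := by exact_mod_cast Nat.pos_of_ne_zero hn
  -- the offset `8(1+σ)/e ≤ 16/e`
  have hoff : 8 * (1 + σ) / ε.toReal ≤ 16 / ε.toReal :=
    div_le_div_of_nonneg_right (by linarith) hepos.le
  have ht' : 8 * (1 + σ) / ε.toReal ≤ n * t := hoff.trans ht
  have key := h.ncmc_occupancy_tail_le_exp_of_sq h0 h1 hT₀ hT₁ hε hD hΔF μ₀ hn ht'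
  refine key.trans (mul_le_mul_of_nonneg_left (Real.exp_le_exp.2 ?_) (by norm_num))
  -- compare the exponents
  have hA : (n * t - 16 / ε.toReal) ^ 2 ≤ (n * t - 8 * (1 + σ) / ε.toReal) ^ 2 := by
    have h1' : 0 ≤ n * t - 16 / ε.toReal := by linarith
    nlinarith [h1', hoff]
  have hB : 32 * n * (1 + σ) ^ 2 / ε.toReal ^ 2 ≤ 128 * n / ε.toReal ^ 2 := by
    refine div_le_div_of_nonneg_right ?_ (by positivity)
    have h4 : (1 + σ) ^ 2 ≤ 4 := by nlinarith [hσ0, hσ1]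
    calc 32 * (n : ℝ) * (1 + σ) ^ 2 ≤ 32 * n * 4 := mul_le_mul_of_nonneg_left h4 (by positivity)
      _ = 128 * n := by ring
  have hBpos : 0 < 32 * n * (1 + σ) ^ 2 / ε.toReal ^ 2 := by positivity
  rw [neg_div]
  refine neg_le_neg ?_
  calc (n * t - 16 / ε.toReal) ^ 2 * ε.toReal ^ 2 / (128 * n)
      = (n * t - 16 / ε.toReal) ^ 2 / (128 * n / ε.toReal ^ 2) := by
        field_simp
    _ ≤ (n * t - 16 / ε.toReal) ^ 2 / (32 * n * (1 + σ) ^ 2 / ε.toReal ^ 2) :=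
        div_le_div_of_nonneg_left (sq_nonneg _) hBpos hB
    _ ≤ (n * t - 8 * (1 + σ) / ε.toReal) ^ 2 / (32 * n * (1 + σ) ^ 2 / ε.toReal ^ 2) :=
        div_le_div_of_nonneg_right hA hBpos.le

/-- **THE CONFIDENCE FORM**: for every initial law `μ₀`, `n ≠ 0` and `n t ≥ 16/e`, the printed
occupancy interval `(p̂_n − t, p̂_n + t)` contains `σ(c − ΔF)` with `P_{μ₀}`-probability at least
`1 − 2 exp(−(n t − 16/e)² e² / (128 n))` — a distribution-free, finite-`n` statement (and, `c − log(x/(1−x))`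
being monotone, a confidence statement for `ΔF`). -/
theorem CrooksPair.ncmc_occupancy_confidence_of_sq (h : CrooksPair ν₀ ν₁ κF κR s e W)
    (h0 : ν₀ univ ≠ 0) (h1 : ν₁ univ ≠ 0) (hT₀ : Kernel.Invariant T₀ ν₀)
    (hT₁ : Kernel.Invariant T₁ ν₁) (hε : ε ≠ 0)
    (hD : haveI := isMarkovKernel_switchKernel (κF := κF) (κR := κR) (c := c)
              h.measurable_W h.measurable_s h.measurable_e
      ∀ z, ε • ν ≤ nHit (switchKernel κF κR c W s e ∘ₖ levelKernel T₀ T₁) 2 z)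
    {ΔF : ℝ} (hΔF : Real.exp (-ΔF) = ((ν₀ univ)⁻¹ * ν₁ univ).toReal)
    (μ₀ : Measure (Bool × Ω)) [IsProbabilityMeasure μ₀] {n : ℕ} (hn : n ≠ 0) {t : ℝ}
    (ht : 16 / ε.toReal ≤ n * t) :
    haveI := isMarkovKernel_switchKernel (κF := κF) (κR := κR) (c := c)
      h.measurable_W h.measurable_s h.measurable_e
    haveI := isMarkovKernel_levelKernel T₀ T₁
    1 - 2 * Real.exp (-((n * t - 16 / ε.toReal) ^ 2 * ε.toReal ^ 2 / (128 * n)))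
      ≤ (Kernel.trajMeasure (X := fun _ : ℕ => Bool × Ω) μ₀
        (fun n : ℕ => (switchKernel κF κR c W s e ∘ₖ levelKernel T₀ T₁).comap
          (fun hh : (j : ↥(Finset.Iic n)) → Bool × Ω => hh ⟨n, Finset.mem_Iic.2 le_rfl⟩)
          (measurable_pi_apply _))).real
        {x | |(∑ i ∈ range n, (targetLevel Ω).indicator (1 : Bool × Ω → ℝ) (x i)) / n
          - Real.sigmoid (c - ΔF)| < t} := by
  haveI := isMarkovKernel_switchKernel (κF := κF) (κR := κR) (c := c)
    h.measurable_W h.measurable_s h.measurable_e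
  haveI := isMarkovKernel_levelKernel T₀ T₁
  set P := Kernel.trajMeasure (X := fun _ : ℕ => Bool × Ω) μ₀
    (fun n : ℕ => (switchKernel κF κR c W s e ∘ₖ levelKernel T₀ T₁).comap
      (fun hh : (j : ↥(Finset.Iic n)) → Bool × Ω => hh ⟨n, Finset.mem_Iic.2 le_rfl⟩)
      (measurable_pi_apply _)) with hP
  have htail := h.ncmc_occupancy_tail_le_exp_of_sq' h0 h1 hT₀ hT₁ hε hD hΔF μ₀ hn ht
  rw [← hP] at htail
  have hgm : Measurable ((targetLevel Ω).indicator (1 : Bool × Ω → ℝ)) :=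
    (targetLevel_indicator_mem (Ω := Ω)).1
  have hFm : Measurable fun x : ℕ → Bool × Ω =>
      |(∑ i ∈ range n, (targetLevel Ω).indicator (1 : Bool × Ω → ℝ) (x i)) / n
        - Real.sigmoid (c - ΔF)| :=
    (((Finset.measurable_sum _ fun i _ => hgm.comp (measurable_pi_apply i)).div_const _).sub
      measurable_const).abs
  have hset : {x : ℕ → Bool × Ω | |(∑ i ∈ range n, (targetLevel Ω).indicator (1 : Bool × Ω → ℝ) (x i)) / n
        - Real.sigmoid (c - ΔF)| < t}
      = {x | t ≤ |(∑ i ∈ range n, (targetLevel Ω).indicator (1 : Bool × Ω → ℝ) (x i)) / n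
        - Real.sigmoid (c - ΔF)|}ᶜ := by
    ext x; simp only [Set.mem_setOf_eq, Set.mem_compl_iff, not_le]
  rw [hset, measureReal_compl (measurableSet_le measurable_const hFm), probReal_univ]
  linarith

/-- **FROM EVERY INITIAL STATE, FOR EVERY `c ≠ ΔF`, A CERTIFICATE EXISTS** (GEN-18
`ncmc_exists_sq_doeblin_of_ne`: level samplers dominating measures `m₀`, `m₁` that dominate
`ν₀`, `ν₁`): there is `ε > 0` such that for every initial law `μ₀`, `n ≠ 0` and `n t ≥ 16/ε.toReal`
the occupancy interval `(p̂_n − t, p̂_n + t)` contains `σ(c − ΔF)` with probability at least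
`1 − 2 exp(−(n t − 16/e)² e² / (128 n))`. -/
theorem CrooksPair.ncmc_occupancy_confidence_of_ne (h : CrooksPair ν₀ ν₁ κF κR s e W)
    (h0 : ν₀ univ ≠ 0) (h1 : ν₁ univ ≠ 0) (hT₀ : Kernel.Invariant T₀ ν₀)
    (hT₁ : Kernel.Invariant T₁ ν₁) {m₀ m₁ : Measure Ω} [IsFiniteMeasure m₀] [IsFiniteMeasure m₁]
    (hm₀ : m₀ univ ≠ 0) (hm₁ : m₁ univ ≠ 0) (hmin₀ : ∀ x, m₀ ≤ T₀ x) (hmin₁ : ∀ y, m₁ ≤ T₁ y)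
    (hac₀ : ν₀ ≪ m₀) (hac₁ : ν₁ ≪ m₁) {ΔF : ℝ}
    (hΔF : Real.exp (-ΔF) = ((ν₀ univ)⁻¹ * ν₁ univ).toReal) (hc : c ≠ ΔF) :
    haveI := isMarkovKernel_switchKernel (κF := κF) (κR := κR) (c := c)
      h.measurable_W h.measurable_s h.measurable_e
    haveI := isMarkovKernel_levelKernel T₀ T₁
    ∃ ε : ℝ≥0∞, ε ≠ 0 ∧ ∀ (μ₀ : Measure (Bool × Ω)) [IsProbabilityMeasure μ₀] {n : ℕ}, n ≠ 0 →
      ∀ {t : ℝ}, 16 / ε.toReal ≤ n * t →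
        1 - 2 * Real.exp (-((n * t - 16 / ε.toReal) ^ 2 * ε.toReal ^ 2 / (128 * n)))
          ≤ (Kernel.trajMeasure (X := fun _ : ℕ => Bool × Ω) μ₀
            (fun n : ℕ => (switchKernel κF κR c W s e ∘ₖ levelKernel T₀ T₁).comap
              (fun hh : (j : ↥(Finset.Iic n)) → Bool × Ω => hh ⟨n, Finset.mem_Iic.2 le_rfl⟩)
              (measurable_pi_apply _))).real
            {x | |(∑ i ∈ range n, (targetLevel Ω).indicator (1 : Bool × Ω → ℝ) (x i)) / n
              - Real.sigmoid (c - ΔF)| < t} := by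
  obtain ⟨ε, ν, hν, hε, hD⟩ := h.ncmc_exists_sq_doeblin_of_ne h0 hm₀ hm₁ hmin₀ hmin₁ hac₀ hac₁ hΔF hc
  haveI := hν
  exact ⟨ε, hε, fun μ₀ _ n hn t ht => h.ncmc_occupancy_confidence_of_sq h0 h1 hT₀ hT₁ hε hD hΔF μ₀ hn ht⟩

end NCMC

/-! ## §2 The free-energy reading of the occupancy interval -/

/-- **Occupancy interval ⇒ free-energy interval** (pointwise): if `|p − σ(c − ΔF)| < t` with `t < p`
and `p + t < 1`, then `c − log((p+t)/(1−(p+t))) < ΔF < c − log((p−t)/(1−(p−t)))` (`logit` is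
increasing and `logit(σ(u)) = u`). -/
theorem freeEnergy_mem_Ioo_of_abs_sub_sigmoid_lt {p t c ΔF : ℝ}
    (h : |p - Real.sigmoid (c - ΔF)| < t) (ht : t < p) (hp : p + t < 1) :
    c - Real.log ((p + t) / (1 - (p + t))) < ΔF ∧ ΔF < c - Real.log ((p - t) / (1 - (p - t))) := by
  set σ := Real.sigmoid (c - ΔF) with hσ
  have hlt := abs_sub_lt_iff.1 h
  have hlo : p - t < σ := by linarith [hlt.1]
  have hhi : σ < p + t := by linarith [hlt.2]
  have hσid : Real.log (σ / (1 - σ)) = c - ΔF := by rw [hσ]; exact log_sigmoid_div _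
  -- `logit` is strictly increasing on `(0, 1)`
  have hlogit : ∀ {a b : ℝ}, 0 < a → a < b → b < 1 → Real.log (a / (1 - a)) < Real.log (b / (1 - b)) := by
    intro a b ha hab hb
    have ha1 : 0 < 1 - a := by linarith
    have hb1 : 0 < 1 - b := by linarith
    refine Real.log_lt_log (div_pos ha ha1) ?_
    rw [div_lt_div_iff₀ ha1 hb1]
    nlinarith
  have h0 : 0 < p - t := by linarith
  constructor
  · have h1 := hlogit (h0.trans hlo) hhi hp
    rw [hσid] at h1
    linarith
  · have h1 := hlogit h0 hlo (by linarith)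
    rw [hσid] at h1
    linarith

section NCMC2

variable {ν₀ ν₁ : Measure Ω} [IsFiniteMeasure ν₀] [IsFiniteMeasure ν₁]
  {κF κR : Kernel Ω E} [IsMarkovKernel κF] [IsMarkovKernel κR] {s e : E → Ω} {W : E → ℝ} {c : ℝ}
  {T₀ T₁ : Kernel Ω Ω} [IsMarkovKernel T₀] [IsMarkovKernel T₁] {ε : ℝ≥0∞}
  {ν : Measure (Bool × Ω)} [IsProbabilityMeasure ν]

/-- **THE FREE-ENERGY CONFIDENCE FORM, FROM EVERY INITIAL LAW.**  Under the hypotheses of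
`CrooksPair.ncmc_occupancy_confidence_of_sq` (`n ≠ 0`, `n t ≥ 16/e`): with `P_{μ₀}`-probability at
least `1 − 2 exp(−(n t − 16/e)² e² / (128 n))`, whenever the occupancy interval is proper
(`t < p̂_n`, `p̂_n + t < 1`) its free-energy image brackets `ΔF`:
`c − log((p̂_n + t)/(1 − p̂_n − t)) < ΔF < c − log((p̂_n − t)/(1 − p̂_n + t))`. -/
theorem CrooksPair.ncmc_freeEnergy_confidence_of_sq (h : CrooksPair ν₀ ν₁ κF κR s e W)
    (h0 : ν₀ univ ≠ 0) (h1 : ν₁ univ ≠ 0) (hT₀ : Kernel.Invariant T₀ ν₀)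
    (hT₁ : Kernel.Invariant T₁ ν₁) (hε : ε ≠ 0)
    (hD : haveI := isMarkovKernel_switchKernel (κF := κF) (κR := κR) (c := c)
              h.measurable_W h.measurable_s h.measurable_e
      ∀ z, ε • ν ≤ nHit (switchKernel κF κR c W s e ∘ₖ levelKernel T₀ T₁) 2 z)
    {ΔF : ℝ} (hΔF : Real.exp (-ΔF) = ((ν₀ univ)⁻¹ * ν₁ univ).toReal)
    (μ₀ : Measure (Bool × Ω)) [IsProbabilityMeasure μ₀] {n : ℕ} (hn : n ≠ 0) {t : ℝ}
    (ht : 16 / ε.toReal ≤ n * t) :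
    haveI := isMarkovKernel_switchKernel (κF := κF) (κR := κR) (c := c)
      h.measurable_W h.measurable_s h.measurable_e
    haveI := isMarkovKernel_levelKernel T₀ T₁
    1 - 2 * Real.exp (-((n * t - 16 / ε.toReal) ^ 2 * ε.toReal ^ 2 / (128 * n)))
      ≤ (Kernel.trajMeasure (X := fun _ : ℕ => Bool × Ω) μ₀
        (fun n : ℕ => (switchKernel κF κR c W s e ∘ₖ levelKernel T₀ T₁).comap
          (fun hh : (j : ↥(Finset.Iic n)) → Bool × Ω => hh ⟨n, Finset.mem_Iic.2 le_rfl⟩)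
          (measurable_pi_apply _))).real
        {x | t < (∑ i ∈ range n, (targetLevel Ω).indicator (1 : Bool × Ω → ℝ) (x i)) / n →
          (∑ i ∈ range n, (targetLevel Ω).indicator (1 : Bool × Ω → ℝ) (x i)) / n + t < 1 →
          c - Real.log (((∑ i ∈ range n, (targetLevel Ω).indicator (1 : Bool × Ω → ℝ) (x i)) / n + t)
              / (1 - ((∑ i ∈ range n, (targetLevel Ω).indicator (1 : Bool × Ω → ℝ) (x i)) / n + t))) < ΔF
          ∧ ΔF < c - Real.log (((∑ i ∈ range n, (targetLevel Ω).indicator (1 : Bool × Ω → ℝ) (x i)) / n - t)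
              / (1 - ((∑ i ∈ range n, (targetLevel Ω).indicator (1 : Bool × Ω → ℝ) (x i)) / n - t)))} := by
  haveI := isMarkovKernel_switchKernel (κF := κF) (κR := κR) (c := c)
    h.measurable_W h.measurable_s h.measurable_e
  haveI := isMarkovKernel_levelKernel T₀ T₁
  refine (h.ncmc_occupancy_confidence_of_sq h0 h1 hT₀ hT₁ hε hD hΔF μ₀ hn ht).trans ?_
  refine measureReal_mono (fun x hx hlt hhi => ?_) (measure_ne_top _ _)
  exact freeEnergy_mem_Ioo_of_abs_sub_sigmoid_lt hx hlt hhi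

end NCMC2

end Summit.Ventures.LatticeQCDFlow.Exactness.GeneralNCMC
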